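import Mathlib
import HarnessLib
import Summits.Ventures.LatticeQCDFlow.Scoring.TwoCodeAgreementInProbability
import Summits.Ventures.LatticeQCDFlow.Scoring.AsymptoticCoverage
import Summits.Ventures.LatticeQCDFlow.Scoring.AgreementTestPower

/-!
# A CONSISTENT agreement rule: with a slowly GROWING window `zₙ → ∞`, `zₙ² = o(n)`, `zₙ² = o(mₙ)`,
# the criterion "A vs B within `zₙ·σ_comb`" is passed with probability `→ 1` by two codes with the
# same target and with probability `→ 0` by two codes with different targets

HONEST FRAMING: exact (Metropolis-corrected) sampling algorithms for lattice gauge theory;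
figures of merit are autocorrelation/cost numbers at stated couplings and volumes; no
continuum-physics claim.

Venture `LatticeQCDFlow` (cell pub-lqcd), topic `Scoring`; FANOUT row 4 (`s0-u1-b`, rung S0-B:
"A vs B within `1σ_comb` at every β").  A FIXED window `z` makes the agreement criterion a
significance test: two exact codes fail it with asymptotic probability `1 − N(0,1)([−z, z]) > 0`
per column (`Scoring/AsymptoticCoverage`), compounding over a table
(`Scoring/SimultaneousAgreementIndependentColumns`: seven independent `1σ` columns pass with
probability `< 0.075`).  The textbook alternative is a window that GROWS with the run length.
This file proves, in the abstract two-code setting of the packet, that it makes the rule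
CONSISTENT.  (i) NULL SIDE, for any statistic with a limit law without atoms: `Tₙ ⇒ Z` and
`zₙ → ∞` ⇒ `P(|Tₙ| ≤ zₙ) → 1` (**`tendsto_measureReal_abs_le_one_of_tendsto_atTop`**: the
window eventually exceeds every fixed `M`, `P(|Tₙ| ≤ M) → P(|Z| ≤ M)`, and `P(|Z| ≤ M) ↑ 1`);
hence for the two-code statistic under equal targets (**`twoSample_agreement_growingWindow_null`**,
from `twoSample_agreement_clt_of_tendstoInMeasure`).  (ii) ALTERNATIVE SIDE: two independent codes
with one-code CLTs centred at `a_A ≠ a_B`, squared standard errors `n·V̂ₙ^X → s_X` in probability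
(`s_A > 0`), code `B` read along `mₙ → ∞`; if `zₙ²/n → 0` and `zₙ²/mₙ → 0` then
`P(|Sₙ^A − S_{mₙ}^B| ≤ zₙ √(V̂ₙ^A + V̂_{mₙ}^B)) → 0` (**`twoSample_agreement_growingWindow_power`**:
the threshold `zₙ √(V̂ₙ^A + V̂_{mₙ}^B) = √((zₙ²/n)(n V̂ₙ^A) + (zₙ²/mₙ)(mₙ V̂_{mₙ}^B)) → 0` in
probability while the difference of the columns `→ a_A − a_B ≠ 0`).  So e.g. `zₙ = √(log n)`
(with `mₙ ≍ n`) gives a rule whose probability of a wrong verdict vanishes on both sides, for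
every column, and — by Bonferroni, `Scoring/SimultaneousAgreement` — for every finite table at
once.  NEW WORK of the cell (textbook; our formalisation); no definition; nothing cited as a fact.
Printed counterparts NAMED ONLY: consistent test sequences / BIC-type thresholds (folklore).

## Content

* `tendsto_measureReal_abs_le_nat_one` — `P(|Z| ≤ M) → 1` as `M → ∞` (any real random variable);
* **`tendsto_measureReal_abs_le_one_of_tendsto_atTop`** — `Tₙ ⇒ Z` (no atoms), `zₙ → ∞` ⇒
  `P(|Tₙ| ≤ zₙ) → 1`;
* **`twoSample_agreement_growingWindow_null`**, **`twoSample_agreement_growingWindow_power`**.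

NOT CLAIMED: an optimal rate for `zₙ`; finite-sample guarantees (those are the certificate files,
`Scoring/TwoCodeUnionBound`); dependent codes; any number of ours.
-/

noncomputable section

namespace Summit.Ventures.LatticeQCDFlow.Scoring.CardConsistency

open MeasureTheory ProbabilityTheory Filter Set
open scoped Topology ENNReal NNReal

/-! ## §1 Null side: a growing window is eventually passed -/

section Null

variable {Ω : Type*} [MeasurableSpace Ω] {P : Measure Ω} [IsProbabilityMeasure P]
variable {Ω' : Type*} [MeasurableSpace Ω'] {P' : Measure Ω'} [IsProbabilityMeasure P']

/-- `P(|Z| ≤ M) → 1` as the natural number `M → ∞`, for any real random variable `Z`. [folklore] -/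
theorem tendsto_measureReal_abs_le_nat_one (Z : Ω' → ℝ) :
    Tendsto (fun M : ℕ => P'.real {ω' | |Z ω'| ≤ M}) atTop (𝓝 1) := by
  have hmono : Monotone fun M : ℕ => {ω' : Ω' | |Z ω'| ≤ M} := by
    intro M M' hMM' ω' hω'
    simp only [mem_setOf_eq] at hω' ⊢
    exact hω'.trans (by exact_mod_cast hMM')
  have hU : (⋃ M : ℕ, {ω' : Ω' | |Z ω'| ≤ M}) = univ := by
    ext ω'
    simp only [mem_iUnion, mem_setOf_eq, mem_univ, iff_true]
    exact exists_nat_ge |Z ω'|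
  have h := tendsto_measure_iUnion_atTop (μ := P') hmono
  rw [hU, measure_univ] at h
  have h' := (ENNReal.tendsto_toReal ENNReal.one_ne_top).comp h
  rw [ENNReal.toReal_one] at h'
  exact h'

/-- **A growing window is eventually passed under the null.**  `Tₙ ⇒ Z` with `P ∘ Z⁻¹` atomless
and `zₙ → ∞` ⇒ `P(|Tₙ| ≤ zₙ) → 1`. [ours] -/
theorem tendsto_measureReal_abs_le_one_of_tendsto_atTop {T : ℕ → Ω → ℝ} {Z : Ω' → ℝ}
    (h : TendstoInDistribution T atTop Z (fun _ => P) P') [NullSingletonClass (P'.map Z)]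
    {z : ℕ → ℝ} (hz : Tendsto z atTop atTop) :
    Tendsto (fun n => P.real {ω | |T n ω| ≤ z n}) atTop (𝓝 1) := by
  have hlim := tendsto_measureReal_abs_le_nat_one (P' := P') Z
  rw [tendsto_order]
  refine ⟨fun a ha => ?_, fun a ha => Eventually.of_forall fun n =>
    lt_of_le_of_lt measureReal_le_one ha⟩
  -- pick `M` with `P(|Z| ≤ M) > a`, then `n` large
  obtain ⟨M, hM⟩ := ((tendsto_order.1 hlim).1 a ha).exists
  have hTM := tendsto_measureReal_abs_le_of_tendstoInDistribution h (M : ℝ)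
  have hev := (tendsto_order.1 hTM).1 a hM
  filter_upwards [hev, hz.eventually (eventually_ge_atTop (M : ℝ))] with n hn hzn
  refine lt_of_lt_of_le hn (measureReal_mono fun ω hω => ?_)
  simp only [mem_setOf_eq] at hω ⊢
  exact hω.trans hzn

end Null

/-! ## §2 The two-code statistic: null and alternative with a growing window -/

section TwoCodes

variable {ΩA : Type*} [MeasurableSpace ΩA] {PA : Measure ΩA} [IsProbabilityMeasure PA]
variable {ΩB : Type*} [MeasurableSpace ΩB] {PB : Measure ΩB} [IsProbabilityMeasure PB]
variable {Ω' : Type*} [MeasurableSpace Ω'] {P' : Measure Ω'} [IsProbabilityMeasure P']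

/-- **NULL: two codes with the same target pass a growing window with probability `→ 1`.**  In the
setting of `twoSample_agreement_clt_of_tendstoInMeasure` (independent codes, one-code CLTs with a
common centring `a`, positive variances, error bars consistent in probability, `mₙ → ∞`) and for
any window `zₙ → ∞`: `(P_A ⊗ P_B)(|Tₙ| ≤ zₙ) → 1`. [ours] -/
theorem twoSample_agreement_growingWindow_null {SA VA : ℕ → ΩA → ℝ} {SB VB : ℕ → ΩB → ℝ}
    {a sA sB : ℝ} {ZA ZB Z : Ω' → ℝ} (hsA : 0 < sA) (hsB : 0 < sB)
    (hSAm : ∀ n, Measurable (SA n)) (hVAm : ∀ n, Measurable (VA n))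
    (hSBm : ∀ n, Measurable (SB n)) (hVBm : ∀ n, Measurable (VB n))
    (hcltA : TendstoInDistribution (fun (n : ℕ) ω => Real.sqrt n * (SA n ω - a)) atTop ZA
      (fun _ => PA) P') (hZA : HasLaw ZA (gaussianReal 0 sA.toNNReal) P')
    (hcltB : TendstoInDistribution (fun (n : ℕ) ω => Real.sqrt n * (SB n ω - a)) atTop ZB
      (fun _ => PB) P') (hZB : HasLaw ZB (gaussianReal 0 sB.toNNReal) P')
    (hVA : TendstoInMeasure PA (fun (n : ℕ) ω => (n : ℝ) * VA n ω) atTop fun _ => sA)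
    (hVB : TendstoInMeasure PB (fun (n : ℕ) ω => (n : ℝ) * VB n ω) atTop fun _ => sB)
    {m : ℕ → ℕ} (hm : Tendsto m atTop atTop) (hZ : HasLaw Z (gaussianReal 0 1) P')
    {z : ℕ → ℝ} (hz : Tendsto z atTop atTop) :
    Tendsto (fun n => (PA.prod PB).real {ω : ΩA × ΩB |
        |(SA n ω.1 - SB (m n) ω.2) / Real.sqrt (VA n ω.1 + VB (m n) ω.2)| ≤ z n}) atTop
      (𝓝 1) := by
  have h := twoSample_agreement_clt_of_tendstoInMeasure hsA hsB hSAm hVAm hSBm hVBm hcltA hZA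
    hcltB hZB hVA hVB hm hZ
  haveI : NullSingletonClass (P'.map Z) := by
    rw [hZ.map_eq]
    exact nullSingletonClass_gaussianReal one_ne_zero
  exact tendsto_measureReal_abs_le_one_of_tendsto_atTop h hz

/-- **ALTERNATIVE: two codes with different targets pass a slowly growing window with
probability `→ 0`.**  Two independent codes with `√n (Sₙ^X − a_X) ⇒ Z_X`, `a_A ≠ a_B`,
squared standard errors with `n·V̂ₙ^A → s_A > 0`, `n·V̂ₙ^B → s_B` in probability (`V̂ₙ^B ≥ 0`),
code `B` read along `mₙ → ∞`; window with `zₙ ≥ 0` eventually, `zₙ²/n → 0`, `zₙ²/mₙ → 0`.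
Then `(P_A ⊗ P_B)(|(Sₙ^A − S_{mₙ}^B)/√(V̂ₙ^A + V̂_{mₙ}^B)| ≤ zₙ) → 0`. [ours] -/
theorem twoSample_agreement_growingWindow_power {SA VA : ℕ → ΩA → ℝ} {SB VB : ℕ → ΩB → ℝ}
    {aA aB sA sB : ℝ} {ZA ZB : Ω' → ℝ} (hab : aA ≠ aB) (hsA : 0 < sA)
    (hVB0 : ∀ n ω, 0 ≤ VB n ω)
    (hcltA : TendstoInDistribution (fun (n : ℕ) ω => Real.sqrt n * (SA n ω - aA)) atTop ZA
      (fun _ => PA) P')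
    (hcltB : TendstoInDistribution (fun (n : ℕ) ω => Real.sqrt n * (SB n ω - aB)) atTop ZB
      (fun _ => PB) P')
    (hVA : TendstoInMeasure PA (fun (n : ℕ) ω => (n : ℝ) * VA n ω) atTop fun _ => sA)
    (hVB : TendstoInMeasure PB (fun (n : ℕ) ω => (n : ℝ) * VB n ω) atTop fun _ => sB)
    {m : ℕ → ℕ} (hm : Tendsto m atTop atTop) {z : ℕ → ℝ} (hz0 : ∀ᶠ n in atTop, 0 ≤ z n)
    (hzA : Tendsto (fun n => z n ^ 2 / n) atTop (𝓝 0))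
    (hzB : Tendsto (fun n => z n ^ 2 / (m n)) atTop (𝓝 0)) :
    Tendsto (fun n => (PA.prod PB).real {ω : ΩA × ΩB |
        |(SA n ω.1 - SB (m n) ω.2) / Real.sqrt (VA n ω.1 + VB (m n) ω.2)| ≤ z n}) atTop
      (𝓝 0) := by
  -- the difference of the columns tends to `Δ = a_A − a_B ≠ 0` in probability
  have hSA : TendstoInMeasure PA SA atTop fun _ => aA :=
    tendstoInMeasure_of_tendstoInDistribution_scaled
      (Real.tendsto_sqrt_atTop.comp tendsto_natCast_atTop_atTop) hcltA
  have hSB : TendstoInMeasure PB SB atTop fun _ => aB :=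
    tendstoInMeasure_of_tendstoInDistribution_scaled
      (Real.tendsto_sqrt_atTop.comp tendsto_natCast_atTop_atTop) hcltB
  have hSA' := tendstoInMeasure_comp_fst (PB := PB) hSA
  have hSB' := tendstoInMeasure_comp_snd (PA := PA) (tendstoInMeasure_comp_tendsto hSB hm)
  have hD : TendstoInMeasure (PA.prod PB) (fun n (ω : ΩA × ΩB) => SA n ω.1 - SB (m n) ω.2)
      atTop fun _ => aA - aB := by
    have hφ : ContinuousAt (fun p : ℝ × ℝ => p.1 - p.2) (aA, aB) := by fun_prop
    have h := tendstoInMeasure_comp_continuousAt_normed (tendstoInMeasure_prodMk hSA' hSB') hφ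
    exact h.congr' (Eventually.of_forall fun n => ae_of_all _ fun ω => rfl)
      (ae_of_all _ fun ω => rfl)
  -- the SCALED pooled squared standard error `zₙ² (V̂ₙ^A + V̂_{mₙ}^B) → 0` in probability
  have hA' : TendstoInMeasure (PA.prod PB) (fun (n : ℕ) (ω : ΩA × ΩB) => (n : ℝ) * VA n ω.1)
      atTop fun _ => sA :=
    tendstoInMeasure_comp_fst hVA
  have hB' : TendstoInMeasure (PA.prod PB)
      (fun (n : ℕ) (ω : ΩA × ΩB) => ((m n : ℕ) : ℝ) * VB (m n) ω.2) atTop fun _ => sB :=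
    tendstoInMeasure_comp_snd (tendstoInMeasure_comp_tendsto hVB hm)
  have hzA' : TendstoInMeasure (PA.prod PB) (fun (n : ℕ) (_ : ΩA × ΩB) => z n ^ 2 / n) atTop
      fun _ => (0 : ℝ) :=
    tendstoInMeasure_of_tendsto_ae (fun n => aestronglyMeasurable_const)
      (Eventually.of_forall fun _ => hzA)
  have hzB' : TendstoInMeasure (PA.prod PB) (fun (n : ℕ) (_ : ΩA × ΩB) => z n ^ 2 / (m n))
      atTop fun _ => (0 : ℝ) :=
    tendstoInMeasure_of_tendsto_ae (fun n => aestronglyMeasurable_const)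
      (Eventually.of_forall fun _ => hzB)
  have hmul : ∀ s : ℝ, ContinuousAt (fun p : ℝ × ℝ => p.1 * p.2) (0, s) := fun s => by
    fun_prop
  have hP1 := tendstoInMeasure_comp_continuousAt_normed (tendstoInMeasure_prodMk hzA' hA')
    (hmul sA)
  have hP2 := tendstoInMeasure_comp_continuousAt_normed (tendstoInMeasure_prodMk hzB' hB')
    (hmul sB)
  simp only [zero_mul] at hP1 hP2
  have hadd : ContinuousAt (fun p : ℝ × ℝ => p.1 + p.2) (0, 0) := by fun_prop
  have hE := tendstoInMeasure_comp_continuousAt_normed (tendstoInMeasure_prodMk hP1 hP2) hadd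
  simp only [add_zero] at hE
  -- `zₙ² (V̂ + V̂) = (zₙ²/n)(n V̂^A) + (zₙ²/mₙ)(mₙ V̂^B)` once `n, mₙ ≥ 1`
  have hE' : TendstoInMeasure (PA.prod PB)
      (fun (n : ℕ) (ω : ΩA × ΩB) => z n ^ 2 * (VA n ω.1 + VB (m n) ω.2)) atTop
      fun _ => (0 : ℝ) := by
    refine hE.congr' ?_ EventuallyEq.rfl
    filter_upwards [eventually_ge_atTop 1, hm.eventually (eventually_ge_atTop 1)] with n hn1 hm1
    refine Eventually.of_forall fun ω => ?_
    have hn0 : (n : ℝ) ≠ 0 := Nat.cast_ne_zero.2 (by omega)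
    have hm0 : ((m n : ℕ) : ℝ) ≠ 0 := Nat.cast_ne_zero.2 (by omega)
    show z n ^ 2 / n * ((n : ℝ) * VA n ω.1) + z n ^ 2 / (m n) * (((m n : ℕ) : ℝ) * VB (m n) ω.2)
      = z n ^ 2 * (VA n ω.1 + VB (m n) ω.2)
    field_simp
  -- conclude: the window event sits inside three small-probability events
  have hA'' := (tendstoInMeasure_iff_norm.1 hA') (sA / 2) (by positivity)
  rw [tendstoInMeasure_iff_norm] at hD hE'
  obtain ⟨δ, hδ, hδlt⟩ : ∃ δ : ℝ, 0 < δ ∧ δ < |aA - aB| / 2 :=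
    ⟨|aA - aB| / 4, by positivity, by
      have : 0 < |aA - aB| := abs_pos.2 (sub_ne_zero.2 hab); linarith⟩
  have hDδ := hD δ hδ
  have hEδ := hE' (δ ^ 2) (by positivity)
  have hsum := (hDδ.add hEδ).add hA''
  rw [add_zero, add_zero] at hsum
  have hup := (ENNReal.tendsto_toReal ENNReal.zero_ne_top).comp hsum
  rw [ENNReal.toReal_zero] at hup
  refine tendsto_of_tendsto_of_tendsto_of_le_of_le' tendsto_const_nhds hup
    (Eventually.of_forall fun n => measureReal_nonneg) ?_
  · filter_upwards [hz0, eventually_ge_atTop 1] with n hzn hn1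
    rw [measureReal_def, Function.comp_apply]
    refine ENNReal.toReal_mono (by finiteness) ((measure_mono fun ω hω => ?_).trans
      ((measure_union_le _ _).trans (add_le_add (measure_union_le _ _) le_rfl)))
    simp only [mem_setOf_eq, mem_union] at hω ⊢
    by_contra hnone
    push Not at hnone
    obtain ⟨⟨h1, h2⟩, h3⟩ := hnone
    rw [Real.norm_eq_abs] at h1 h2 h3
    -- outside the three events: `|D − Δ| < δ`, `zₙ² (V̂+V̂) < δ²`, `|n V̂^A − s_A| < s_A/2`
    have hVApos : 0 < VA n ω.1 := by
      have hlt := h3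
      rw [abs_sub_lt_iff] at hlt
      have hnV : 0 < (n : ℝ) * VA n ω.1 := by linarith [hlt.1, hlt.2]
      have hn0 : (0 : ℝ) < n := by exact_mod_cast hn1
      by_contra hle
      have : (n : ℝ) * VA n ω.1 ≤ 0 :=
        mul_nonpos_of_nonneg_of_nonpos hn0.le (not_lt.1 hle)
      linarith
    have hV : 0 < VA n ω.1 + VB (m n) ω.2 := add_pos_of_pos_of_nonneg hVApos (hVB0 _ _)
    have hDlarge : |aA - aB| / 2 < |SA n ω.1 - SB (m n) ω.2| := by
      have h0 := abs_sub_abs_le_abs_sub (aA - aB) (SA n ω.1 - SB (m n) ω.2)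
      rw [abs_sub_comm (aA - aB) (SA n ω.1 - SB (m n) ω.2)] at h0
      linarith [h1]
    have hsmall : z n ^ 2 * (VA n ω.1 + VB (m n) ω.2) < δ ^ 2 := by
      have := h2
      rw [sub_zero, abs_of_nonneg (mul_nonneg (sq_nonneg _) hV.le)] at this
      exact this
    -- from `|T| ≤ zₙ`: `|D| ≤ zₙ √(V̂+V̂)`, so `D² ≤ zₙ² (V̂+V̂) < δ² < D²`
    have hs : 0 < Real.sqrt (VA n ω.1 + VB (m n) ω.2) := Real.sqrt_pos.2 hV
    have hTle : |SA n ω.1 - SB (m n) ω.2| ≤ z n * Real.sqrt (VA n ω.1 + VB (m n) ω.2) := by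
      rw [abs_div, abs_of_pos hs, div_le_iff₀ hs] at hω
      exact hω
    have hsq : (SA n ω.1 - SB (m n) ω.2) ^ 2 ≤ z n ^ 2 * (VA n ω.1 + VB (m n) ω.2) := by
      calc (SA n ω.1 - SB (m n) ω.2) ^ 2 = |SA n ω.1 - SB (m n) ω.2| ^ 2 := (sq_abs _).symm
        _ ≤ (z n * Real.sqrt (VA n ω.1 + VB (m n) ω.2)) ^ 2 :=
            pow_le_pow_left₀ (abs_nonneg _) hTle 2
        _ = z n ^ 2 * (VA n ω.1 + VB (m n) ω.2) := by
            rw [mul_pow, Real.sq_sqrt hV.le]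
    have hδ2 : δ < |SA n ω.1 - SB (m n) ω.2| := by linarith
    have hlt2 : δ ^ 2 < (SA n ω.1 - SB (m n) ω.2) ^ 2 := by
      calc δ ^ 2 < |SA n ω.1 - SB (m n) ω.2| ^ 2 := pow_lt_pow_left₀ hδ2 hδ.le two_ne_zero
        _ = _ := sq_abs _
    linarith

end TwoCodes

end Summit.Ventures.LatticeQCDFlow.Scoring.CardConsistency

end
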